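import Summits.AnomalousDissipation.AnomalousDissipation.Theorems.MarginalStabilityChainStrainedLayerLawSumRuleLine
import Literature.Analysis.FluidPDE.StretchedLayerStripIdentities
import Literature.Analysis.FluidPDE.StretchedLayerEnergyClass
import Mathlib.Analysis.Calculus.ParametricIntegral
import HarnessLib

/-!
# Stub `stub_strainWorkIdentity` of line `strain-work-sum-rule` (crux `MarginalStabilityChain.StrainedLayerLaw`,
# stmt-AnomalousDissipation-3007) — tool file A: slice toolkit

Support file (`--supports stmt-AnomalousDissipation-3007`; registered sub-goal
`stub_strainWorkIdentity_viscous`). Elementary real-variable tools for the energy budget of the stretched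
two-dimensional Navier–Stokes shear layer (Majda–Bertozzi 2002, §3.1.1 basic energy identity, with the strain
drift added), all proved:

* pointwise consequences of the shear-tails predicate `SliceTails C k u v` of the line (`C ≥ 0`, `|u| ≤ 1 + C`,
  decay of `v`, of the velocity gradient, of the Laplacians, of the energy density `(u² + v² − ¼)/2` and of the
  strain-work density `(¼ − u² + v²)/2`);
* the slice derivatives of the energy density `(a² + b² − ¼)/2`;
* **the viscous EQUALITY on the period strip** `∫∫_{(0,L]×ℝ} f Δf = −∫∫_{(0,L]×ℝ} |∇f|²` for a bounded `C²`
  field, `L`-periodic in `x`, whose gradient and Laplacian decay like `e^{−k|y|}` across the layer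
  (`stub_strainWorkIdentity_viscous`; the tree's `integral_strip_mul_lap_self_nonpos` is the one-sided version).
  Proof: in `x`, periodic integration by parts on every line `y = const`; in `y`, the line functional
  `g(y) = ∫₀ᴸ f ∂_yf dx` is differentiated under the integral sign, `g′ = ∫₀ᴸ ((∂_yf)² + f ∂_y∂_yf) dx`, so that
  `g′(y) = φ(y) + ψ(y)` with `φ = ∫₀ᴸ fΔf dx`, `ψ = ∫₀ᴸ |∇f|² dx` both integrable on `ℝ` (Fubini), and
  `∫_ℝ g′ = g(+∞) − g(−∞) = 0` (`|g| ≤ LBCe^{−k|y|}`).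

References: A. J. Majda, A. L. Bertozzi, *Vorticity and Incompressible Flow*, CUP 2002, §3.1.1 (p. 87–88).
-/

-- `Summit.<Summit>.<Problem>` is the tree's mandated summit-side namespace (CONVENTIONS §2); for this
-- single-conjunct summit the two coincide, so the duplicate is deliberate.
set_option linter.dupNamespace false

noncomputable section

open scoped Topology ENNReal
open Filter Set Function MeasureTheory

namespace Summit.AnomalousDissipation.AnomalousDissipation.Theorems.StrainedLayerLaw.StrainWorkSumRule

open Literature.Analysis.FluidPDE Literature.Analysis.FluidPDE.StretchedLayer

/-! ## Pointwise consequences of `SliceTails` -/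

/-- The layer weight `e^{−k|y|} ≤ 1` for `k > 0`. [folklore] -/
theorem exp_neg_mul_abs_le_one {k : ℝ} (hk : 0 < k) (y : ℝ) : Real.exp (-k * |y|) ≤ 1 :=
  Real.exp_le_one_iff.2 (by nlinarith [abs_nonneg y])

variable {C k : ℝ} {f g : ℝ → ℝ → ℝ}

/-- The tails constant is nonnegative. [folklore] -/
theorem SliceTails.nonneg (h : SliceTails C k f g) : 0 ≤ C := by
  have h1 := (abs_nonneg _).trans (h 0 0).2.1
  rw [abs_zero, mul_zero, Real.exp_zero, mul_one] at h1
  exact h1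

/-- `|v| ≤ Ce^{−k|y|}`. [folklore] -/
theorem SliceTails.abs_v_le (h : SliceTails C k f g) (x y : ℝ) :
    |g x y| ≤ C * Real.exp (-k * |y|) := (h x y).2.1

/-- `|v| ≤ C`. [folklore] -/
theorem SliceTails.abs_v_le_const (h : SliceTails C k f g) (hk : 0 < k) (x y : ℝ) : |g x y| ≤ C :=
  (h.abs_v_le x y).trans (mul_le_of_le_one_right h.nonneg (exp_neg_mul_abs_le_one hk y))

/-- `|u| ≤ 1 + C` (from `u² ≤ ¼ + Ce^{−k|y|} − v²`). [folklore] -/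
theorem SliceTails.abs_u_le (h : SliceTails C k f g) (hk : 0 < k) (x y : ℝ) : |f x y| ≤ 1 + C := by
  have hC := h.nonneg
  have h1 := (abs_le.1 (h x y).1).2
  have he := exp_neg_mul_abs_le_one hk y
  have he0 := Real.exp_pos (-k * |y|)
  refine abs_le_of_sq_le_sq ?_ (by linarith)
  nlinarith [sq_nonneg (g x y), mul_le_mul_of_nonneg_left he hC]

/-- `|∂ₓu| ≤ Ce^{−k|y|}`. [folklore] -/
theorem SliceTails.abs_dX_u_le (h : SliceTails C k f g) (x y : ℝ) :
    |dX f x y| ≤ C * Real.exp (-k * |y|) := by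
  linarith [(h x y).2.2.1, abs_nonneg (dY f x y), abs_nonneg (dX g x y), abs_nonneg (dY g x y)]

/-- `|∂_yu| ≤ Ce^{−k|y|}`. [folklore] -/
theorem SliceTails.abs_dY_u_le (h : SliceTails C k f g) (x y : ℝ) :
    |dY f x y| ≤ C * Real.exp (-k * |y|) := by
  linarith [(h x y).2.2.1, abs_nonneg (dX f x y), abs_nonneg (dX g x y), abs_nonneg (dY g x y)]

/-- `|∂ₓv| ≤ Ce^{−k|y|}`. [folklore] -/
theorem SliceTails.abs_dX_v_le (h : SliceTails C k f g) (x y : ℝ) :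
    |dX g x y| ≤ C * Real.exp (-k * |y|) := by
  linarith [(h x y).2.2.1, abs_nonneg (dX f x y), abs_nonneg (dY f x y), abs_nonneg (dY g x y)]

/-- `|∂_yv| ≤ Ce^{−k|y|}`. [folklore] -/
theorem SliceTails.abs_dY_v_le (h : SliceTails C k f g) (x y : ℝ) :
    |dY g x y| ≤ C * Real.exp (-k * |y|) := by
  linarith [(h x y).2.2.1, abs_nonneg (dX f x y), abs_nonneg (dY f x y), abs_nonneg (dX g x y)]

/-- `|∂ₓu| + |∂_yu| ≤ Ce^{−k|y|}`. [folklore] -/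
theorem SliceTails.abs_grad_u_le (h : SliceTails C k f g) (x y : ℝ) :
    |dX f x y| + |dY f x y| ≤ C * Real.exp (-k * |y|) := by
  linarith [(h x y).2.2.1, abs_nonneg (dX g x y), abs_nonneg (dY g x y)]

/-- `|∂ₓv| + |∂_yv| ≤ Ce^{−k|y|}`. [folklore] -/
theorem SliceTails.abs_grad_v_le (h : SliceTails C k f g) (x y : ℝ) :
    |dX g x y| + |dY g x y| ≤ C * Real.exp (-k * |y|) := by
  linarith [(h x y).2.2.1, abs_nonneg (dX f x y), abs_nonneg (dY f x y)]

/-- `|Δu| ≤ Ce^{−k|y|}`. [folklore] -/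
theorem SliceTails.abs_lap_u_le (h : SliceTails C k f g) (x y : ℝ) :
    |lap f x y| ≤ C * Real.exp (-k * |y|) := by
  linarith [(h x y).2.2.2, abs_nonneg (lap g x y)]

/-- `|Δv| ≤ Ce^{−k|y|}`. [folklore] -/
theorem SliceTails.abs_lap_v_le (h : SliceTails C k f g) (x y : ℝ) :
    |lap g x y| ≤ C * Real.exp (-k * |y|) := by
  linarith [(h x y).2.2.2, abs_nonneg (lap f x y)]

/-- The squared gradient decays: `|(∂ₓu)² + (∂_yu)² + (∂ₓv)² + (∂_yv)²| ≤ C²e^{−k|y|}`. [folklore] -/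
theorem SliceTails.abs_gradSq_le (h : SliceTails C k f g) (hk : 0 < k) (x y : ℝ) :
    |dX f x y ^ 2 + dY f x y ^ 2 + dX g x y ^ 2 + dY g x y ^ 2| ≤ C ^ 2 * Real.exp (-k * |y|) := by
  have hs := (h x y).2.2.1
  have he := exp_neg_mul_abs_le_one hk y
  have he0 := Real.exp_pos (-k * |y|)
  have hC := h.nonneg
  rw [abs_of_nonneg (by positivity)]
  have hsum : 0 ≤ |dX f x y| + |dY f x y| + |dX g x y| + |dY g x y| := by positivity
  have hsq : (|dX f x y| + |dY f x y| + |dX g x y| + |dY g x y|) ^ 2 ≤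
      (C * Real.exp (-k * |y|)) ^ 2 := pow_le_pow_left₀ hsum hs 2
  nlinarith [sq_abs (dX f x y), sq_abs (dY f x y), sq_abs (dX g x y), sq_abs (dY g x y),
    abs_nonneg (dX f x y), abs_nonneg (dY f x y), abs_nonneg (dX g x y), abs_nonneg (dY g x y),
    mul_le_mul_of_nonneg_left he (mul_nonneg (mul_nonneg hC hC) he0.le)]

/-- The excess energy density decays: `|(u² + v² − ¼)/2| ≤ (C/2)e^{−k|y|}`. [folklore] -/
theorem SliceTails.abs_energyDensity_le (h : SliceTails C k f g) (x y : ℝ) :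
    |(f x y ^ 2 + g x y ^ 2 - 1 / 4) / 2| ≤ C / 2 * Real.exp (-k * |y|) := by
  rw [abs_div, abs_two]
  linarith [(h x y).1]

/-- `v²` decays: `v² ≤ C²e^{−k|y|}`. [folklore] -/
theorem SliceTails.sq_v_le (h : SliceTails C k f g) (hk : 0 < k) (x y : ℝ) :
    g x y ^ 2 ≤ C ^ 2 * Real.exp (-k * |y|) := by
  have h1 : |g x y| * |g x y| ≤ C * (C * Real.exp (-k * |y|)) :=
    mul_le_mul (h.abs_v_le_const hk x y) (h.abs_v_le x y) (abs_nonneg _) h.nonneg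
  rw [abs_mul_abs_self] at h1
  nlinarith

/-- The strain-work density decays: `|(¼ − u² + v²)/2| ≤ (C/2 + C²)e^{−k|y|}`. [folklore] -/
theorem SliceTails.abs_workDensity_le (h : SliceTails C k f g) (hk : 0 < k) (x y : ℝ) :
    |(1 / 4 - f x y ^ 2 + g x y ^ 2) / 2| ≤ (C / 2 + C ^ 2) * Real.exp (-k * |y|) := by
  have h1 := h.abs_energyDensity_le x y
  have h2 := h.sq_v_le hk x y
  have e : (1 / 4 - f x y ^ 2 + g x y ^ 2) / 2 = -((f x y ^ 2 + g x y ^ 2 - 1 / 4) / 2) + g x y ^ 2 := by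
    ring
  rw [e]
  refine (abs_add_le _ _).trans ?_
  rw [abs_neg, abs_of_nonneg (sq_nonneg (g x y))]
  linarith

/-! ## The slice derivatives of the excess energy density -/

/-- `∂ₓ (a² + b² − ¼)/2 = a ∂ₓa + b ∂ₓb` where the `x`-slices are differentiable. [folklore] -/
theorem dX_energyDensity {a b : ℝ → ℝ → ℝ} {x y : ℝ}
    (ha : DifferentiableAt ℝ (fun s => a s y) x) (hb : DifferentiableAt ℝ (fun s => b s y) x) :
    dX (fun r s => (a r s ^ 2 + b r s ^ 2 - 1 / 4) / 2) x y = a x y * dX a x y + b x y * dX b x y := by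
  have h : HasDerivAt (fun s => (a s y ^ 2 + b s y ^ 2 - 1 / 4) / 2)
      ((↑(2 : ℕ) * a x y ^ (2 - 1) * deriv (fun s => a s y) x +
        ↑(2 : ℕ) * b x y ^ (2 - 1) * deriv (fun s => b s y) x - 0) / 2) x :=
    (((ha.hasDerivAt.pow 2).add (hb.hasDerivAt.pow 2)).sub (hasDerivAt_const x (1 / 4 : ℝ))).div_const 2
  rw [dX, h.deriv, dX, dX]
  norm_num
  ring

/-- `∂_y (a² + b² − ¼)/2 = a ∂_ya + b ∂_yb` where the `y`-slices are differentiable. [folklore] -/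
theorem dY_energyDensity {a b : ℝ → ℝ → ℝ} {x y : ℝ}
    (ha : DifferentiableAt ℝ (fun s => a x s) y) (hb : DifferentiableAt ℝ (fun s => b x s) y) :
    dY (fun r s => (a r s ^ 2 + b r s ^ 2 - 1 / 4) / 2) x y = a x y * dY a x y + b x y * dY b x y := by
  have h : HasDerivAt (fun s => (a x s ^ 2 + b x s ^ 2 - 1 / 4) / 2)
      ((↑(2 : ℕ) * a x y ^ (2 - 1) * deriv (fun s => a x s) y +
        ↑(2 : ℕ) * b x y ^ (2 - 1) * deriv (fun s => b x s) y - 0) / 2) y :=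
    (((ha.hasDerivAt.pow 2).add (hb.hasDerivAt.pow 2)).sub (hasDerivAt_const y (1 / 4 : ℝ))).div_const 2
  rw [dY, h.deriv, dY, dY]
  norm_num
  ring

/-- The excess energy density of `Cⁿ` fields is `Cⁿ`. [folklore] -/
theorem contDiff_energyDensity {a b : ℝ → ℝ → ℝ} {n : WithTop ℕ∞}
    (ha : ContDiff ℝ n (fun q : ℝ × ℝ => a q.1 q.2))
    (hb : ContDiff ℝ n (fun q : ℝ × ℝ => b q.1 q.2)) :
    ContDiff ℝ n (fun q : ℝ × ℝ => (a q.1 q.2 ^ 2 + b q.1 q.2 ^ 2 - 1 / 4) / 2) :=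
  (((ha.pow 2).add (hb.pow 2)).sub contDiff_const).div_const 2

/-! ## The viscous equality on the period strip -/

/-- **Viscous equality on the period strip** (registered sub-goal `stub_strainWorkIdentity_viscous`). For a `C²`
plane field `f`, `L`-periodic in `x` (`L > 0`), bounded, with `|∂ₓf| + |∂_yf| ≤ Ce^{−k|y|}` and `|Δf| ≤ Ce^{−k|y|}`
(`k > 0`): `fΔf` and `|∇f|²` are integrable on the strip `(0,L] × ℝ` and `∫∫ fΔf = −∫∫ |∇f|²`
(Majda–Bertozzi 2002, §3.1.1: `∫ Δṽ·ṽ = −∫|∇ṽ|²`; periodic integration by parts in `x` on every line, and in `y`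
the line functional `g(y) = ∫₀ᴸ f∂_yf dx` has `g′ = ∫₀ᴸ fΔf dx + ∫₀ᴸ |∇f|² dx` with `g(±∞) = 0`). [folklore] -/
theorem stub_strainWorkIdentity_viscous : ∀ (L k B C : ℝ) (f : ℝ → ℝ → ℝ), 0 < L → 0 < k →
    ContDiff ℝ 2 (fun q : ℝ × ℝ => f q.1 q.2) → (∀ x y, f (x + L) y = f x y) →
    (∀ x y, |f x y| ≤ B) → (∀ x y, |dX f x y| + |dY f x y| ≤ C * Real.exp (-k * |y|)) →
    (∀ x y, |lap f x y| ≤ C * Real.exp (-k * |y|)) →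
      IntegrableOn (fun q : ℝ × ℝ => f q.1 q.2 * lap f q.1 q.2) (Ioc 0 L ×ˢ univ) ∧
      IntegrableOn (fun q : ℝ × ℝ => dX f q.1 q.2 ^ 2 + dY f q.1 q.2 ^ 2) (Ioc 0 L ×ˢ univ) ∧
      ∫ q in Ioc 0 L ×ˢ univ, f q.1 q.2 * lap f q.1 q.2 =
        -∫ q in Ioc 0 L ×ˢ univ, (dX f q.1 q.2 ^ 2 + dY f q.1 q.2 ^ 2) := by
  intro L k B C f hL hk hf hper hB h1 h2
  -- constants and atomic bounds
  have hC : 0 ≤ C := by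
    have h0 := (abs_nonneg _).trans (h2 0 0)
    rw [abs_zero, mul_zero, Real.exp_zero, mul_one] at h0
    exact h0
  have hB0 : 0 ≤ B := (abs_nonneg _).trans (hB 0 0)
  have he1 : ∀ y : ℝ, Real.exp (-k * |y|) ≤ 1 := exp_neg_mul_abs_le_one hk
  have hfx : ∀ x y, |dX f x y| ≤ C * Real.exp (-k * |y|) := fun x y => by
    linarith [h1 x y, abs_nonneg (dY f x y)]
  have hfy : ∀ x y, |dY f x y| ≤ C * Real.exp (-k * |y|) := fun x y => by
    linarith [h1 x y, abs_nonneg (dX f x y)]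
  have hfyC : ∀ x y, |dY f x y| ≤ C := fun x y =>
    (hfy x y).trans (mul_le_of_le_one_right hC (he1 y))
  -- regularity atoms
  have hf1 : ContDiff ℝ 1 (fun q : ℝ × ℝ => f q.1 q.2) := hf.of_le one_le_two
  have cf : Continuous (fun q : ℝ × ℝ => f q.1 q.2) := hf.continuous
  have cfx := continuous_dX hf1
  have cfy := continuous_dY hf1
  have cfxx := continuous_dXdX hf
  have cfyy := continuous_dYdY hf
  have clap : Continuous (fun q : ℝ × ℝ => lap f q.1 q.2) := by
    simp only [lap_apply]; exact cfxx.add cfyy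
  have dfx : ∀ x y, HasDerivAt (fun s => f s y) (dX f x y) x := hasDerivAt_dX_of_contDiff hf two_ne_zero
  have dfy : ∀ x y, HasDerivAt (fun s => f x s) (dY f x y) y := hasDerivAt_dY_of_contDiff hf two_ne_zero
  have dfxx : ∀ x y, HasDerivAt (fun s => dX f s y) (dX (dX f) x y) x :=
    hasDerivAt_dX_of_contDiff (contDiff_one_dX hf) one_ne_zero
  have dfyy : ∀ x y, HasDerivAt (fun s => dY f x s) (dY (dY f) x y) y :=
    hasDerivAt_dY_of_contDiff (contDiff_one_dY hf) one_ne_zero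
  -- integrability on the strip
  have iI : IntegrableOn (fun q : ℝ × ℝ => f q.1 q.2 * lap f q.1 q.2) (Ioc 0 L ×ˢ univ) :=
    integrableOn_strip_of_abs_le_exp (cf.mul clap) (mul_nonneg hB0 hC) hk fun x _ y => by
      rw [abs_mul]
      calc |f x y| * |lap f x y| ≤ B * (C * Real.exp (-k * |y|)) :=
            mul_le_mul (hB x y) (h2 x y) (abs_nonneg _) hB0
        _ = B * C * Real.exp (-k * |y|) := by ring
  have iG : IntegrableOn (fun q : ℝ × ℝ => dX f q.1 q.2 ^ 2 + dY f q.1 q.2 ^ 2) (Ioc 0 L ×ˢ univ) :=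
    integrableOn_strip_of_abs_le_exp ((cfx.pow 2).add (cfy.pow 2)) (mul_nonneg hC hC) hk fun x _ y => by
      rw [abs_of_nonneg (by positivity)]
      have hs := h1 x y
      have hsum : 0 ≤ |dX f x y| + |dY f x y| := by positivity
      have hsq : (|dX f x y| + |dY f x y|) ^ 2 ≤ (C * Real.exp (-k * |y|)) ^ 2 :=
        pow_le_pow_left₀ hsum hs 2
      nlinarith [sq_abs (dX f x y), sq_abs (dY f x y), abs_nonneg (dX f x y), abs_nonneg (dY f x y),
        mul_le_mul_of_nonneg_left (he1 y) (mul_nonneg (mul_nonneg hC hC) (Real.exp_pos (-k * |y|)).le)]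
  refine ⟨iI, iG, ?_⟩
  -- the two line functionals and Fubini
  set φ : ℝ → ℝ := fun y => ∫ x in Ioc 0 L, f x y * lap f x y with hφ_def
  set ψ : ℝ → ℝ := fun y => ∫ x in Ioc 0 L, (dX f x y ^ 2 + dY f x y ^ 2) with hψ_def
  have iI' := iI
  have iG' := iG
  rw [IntegrableOn, volume_restrict_strip] at iI' iG'
  have hFubI : ∫ q in Ioc 0 L ×ˢ univ, f q.1 q.2 * lap f q.1 q.2 = ∫ y, φ y := by
    rw [volume_restrict_strip, integral_prod_symm _ iI']
  have hFubG : ∫ q in Ioc 0 L ×ˢ univ, (dX f q.1 q.2 ^ 2 + dY f q.1 q.2 ^ 2) = ∫ y, ψ y := by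
    rw [volume_restrict_strip, integral_prod_symm _ iG']
  have iφ : Integrable φ := iI'.integral_prod_right
  have iψ : Integrable ψ := iG'.integral_prod_right
  -- periodic integration by parts in `x` on every line
  have hxline : ∀ y, ∫ x in Ioc 0 L, f x y * dX (dX f) x y = -∫ x in Ioc 0 L, dX f x y * dX f x y := by
    intro y
    rw [← intervalIntegral.integral_of_le hL.le, ← intervalIntegral.integral_of_le hL.le,
      intervalIntegral.integral_mul_deriv_eq_deriv_mul (fun x _ => dfx x y) (fun x _ => dfxx x y)
        ((continuous_slice_x cfx y).intervalIntegrable _ _)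
        ((continuous_slice_x cfxx y).intervalIntegrable _ _)]
    have hp1 : f L y = f 0 y := by simpa using hper 0 y
    have hp2 : dX f L y = dX f 0 y := by simpa using dX_periodic hper 0 y
    rw [hp1, hp2, sub_self, zero_sub]
  -- the line functional `g(y) = ∫₀ᴸ f ∂_yf dx` and its derivative
  set g : ℝ → ℝ := fun y => ∫ x in Ioc 0 L, f x y * dY f x y with hg_def
  have hg' : ∀ y, HasDerivAt g
      (∫ x in Ioc 0 L, (dY f x y * dY f x y + f x y * dY (dY f) x y)) y := by
    intro y
    obtain ⟨M, hM⟩ := (isCompact_Icc.prod isCompact_Icc :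
        IsCompact (Icc (0:ℝ) L ×ˢ Icc (y - 1) (y + 1))).exists_bound_of_continuousOn
      (f := fun q : ℝ × ℝ => dY (dY f) q.1 q.2) cfyy.continuousOn
    have hM0 : 0 ≤ M := (norm_nonneg _).trans (hM (0, y) ⟨⟨le_rfl, hL.le⟩, by constructor <;> linarith⟩)
    have key := hasDerivAt_integral_of_dominated_loc_of_deriv_le
      (μ := volume.restrict (Ioc 0 L)) (x₀ := y) (s := Ioo (y - 1) (y + 1))
      (F := fun y' x => f x y' * dY f x y')
      (F' := fun y' x => dY f x y' * dY f x y' + f x y' * dY (dY f) x y')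
      (bound := fun _ => C * C + B * M) (Ioo_mem_nhds (by linarith) (by linarith))
      (Eventually.of_forall fun y' =>
        ((continuous_slice_x cf y').mul (continuous_slice_x cfy y')).aestronglyMeasurable)
      (((continuous_slice_x cf y).mul (continuous_slice_x cfy y)).integrableOn_Ioc)
      (((continuous_slice_x cfy y).mul (continuous_slice_x cfy y)).add
        ((continuous_slice_x cf y).mul (continuous_slice_x cfyy y))).aestronglyMeasurable
      ?_ (integrable_const _) (Eventually.of_forall fun x y' _ => (dfy x y').mul (dfyy x y'))
    · exact key.2
    · filter_upwards [ae_restrict_mem measurableSet_Ioc] with x hx y' hy'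
      have hq : (x, y') ∈ Icc (0:ℝ) L ×ˢ Icc (y - 1) (y + 1) :=
        ⟨⟨hx.1.le, hx.2⟩, ⟨hy'.1.le, hy'.2.le⟩⟩
      have h3 : |dY (dY f) x y'| ≤ M := by have := hM _ hq; rwa [Real.norm_eq_abs] at this
      rw [Real.norm_eq_abs]
      refine (abs_add_le _ _).trans ?_
      rw [abs_mul, abs_mul]
      exact add_le_add (mul_le_mul (hfyC x y') (hfyC x y') (abs_nonneg _) hC)
        (mul_le_mul (hB x y') h3 (abs_nonneg _) hB0)
  -- `g′ = φ + ψ`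
  have hg'2 : ∀ y, HasDerivAt g (φ y + ψ y) y := by
    intro y
    refine (hg' y).congr_deriv ?_
    have i1 : IntegrableOn (fun x => dY f x y * dY f x y) (Ioc 0 L) :=
      ((continuous_slice_x cfy y).mul (continuous_slice_x cfy y)).integrableOn_Ioc
    have i2 : IntegrableOn (fun x => f x y * dY (dY f) x y) (Ioc 0 L) :=
      ((continuous_slice_x cf y).mul (continuous_slice_x cfyy y)).integrableOn_Ioc
    have i3 : IntegrableOn (fun x => f x y * dX (dX f) x y) (Ioc 0 L) :=
      ((continuous_slice_x cf y).mul (continuous_slice_x cfxx y)).integrableOn_Ioc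
    have i4 : IntegrableOn (fun x => dX f x y * dX f x y) (Ioc 0 L) :=
      ((continuous_slice_x cfx y).mul (continuous_slice_x cfx y)).integrableOn_Ioc
    have eφ : φ y = (∫ x in Ioc 0 L, f x y * dX (dX f) x y) + ∫ x in Ioc 0 L, f x y * dY (dY f) x y := by
      simp only [hφ_def]
      rw [← integral_add i3 i2]
      refine integral_congr_ae (Eventually.of_forall fun x => ?_)
      simp only [lap_apply]
      ring
    have eψ : ψ y = (∫ x in Ioc 0 L, dX f x y * dX f x y) + ∫ x in Ioc 0 L, dY f x y * dY f x y := by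
      simp only [hψ_def]
      rw [← integral_add i4 i1]
      refine integral_congr_ae (Eventually.of_forall fun x => ?_)
      simp only
      ring
    rw [integral_add i1 i2, eφ, eψ, hxline]
    ring
  -- `g(±∞) = 0`
  have hgb : ∀ y, |g y| ≤ L * (B * C) * Real.exp (-k * |y|) := by
    intro y
    have h3 := norm_setIntegral_le_of_norm_le_const (μ := volume) (s := Ioc 0 L)
      (f := fun x => f x y * dY f x y) (C := B * C * Real.exp (-k * |y|))
      (by rw [Real.volume_Ioc]; exact ENNReal.ofReal_lt_top) fun x _ => by
        rw [Real.norm_eq_abs, abs_mul]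
        calc |f x y| * |dY f x y| ≤ B * (C * Real.exp (-k * |y|)) :=
              mul_le_mul (hB x y) (hfy x y) (abs_nonneg _) hB0
          _ = B * C * Real.exp (-k * |y|) := by ring
    rw [Real.volume_real_Ioc_of_le hL.le, sub_zero, Real.norm_eq_abs] at h3
    calc |g y| ≤ B * C * Real.exp (-k * |y|) * L := h3
      _ = L * (B * C) * Real.exp (-k * |y|) := by ring
  have htop : Tendsto g atTop (𝓝 0) := tendsto_zero_atTop_of_abs_le_exp hk hgb
  have hbot : Tendsto g atBot (𝓝 0) := tendsto_zero_atBot_of_abs_le_exp hk hgb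
  have hzero : ∫ y, (φ y + ψ y) = 0 - 0 :=
    integral_of_hasDerivAt_of_tendsto hg'2 (iφ.add iψ) hbot htop
  rw [integral_add iφ iψ, sub_zero] at hzero
  rw [hFubI, hFubG]
  linarith

end Summit.AnomalousDissipation.AnomalousDissipation.Theorems.StrainedLayerLaw.StrainWorkSumRule

end
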